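/-
Copyright (c) 2026 the pub-hodgecm-mathlib formalisation cell (harness21).  Prover seat hodgecm-mathlib-K2Liu-p02 (g0): Track B «K2-LIT», #184♮ = hLiu418,
organ O41.1 of socket #41 `sig_K2LiuSiegelEisensteinContinuation` (U6 «FIRST TERM»; steward K2Liu-p01 (g0); LEAD F0P6-plan (g10) DEAL 2026-09-03T22:32:11Z).
-/
import Mathlib.LinearAlgebra.Matrix.NonsingularInverse
import Mathlib.LinearAlgebra.Matrix.Rank
import Mathlib.Data.Matrix.Block
import HarnessLib

/-!
# Crux `HLiu418`, Track B road `K2_Liu`, unit U6, organ O41.1 (PART A): the BRUHAT CELLS of the Siegel parabolic in block-matrix form —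
# cell invariance of the lower-left block, the small cell, and the BIG CELL `P_Δ w_Δ P_Δ = P_Δ w_Δ N_Δ` with FREE `N_Δ`-component

Cell `hodgecm-mathlib`, crux item hLiu418 = `stmt-HodgeConjecture-24832`; prover K2Liu-p02 (g0) for steward K2Liu-p01 (g0)'s organ list of #41
(`K2/K2Liu-p01/g0/REPORT-FIRST-41-SiegelEisensteinContinuation.K2Liup01g0.md`, row O41.1).  THEOREMS ONLY, Mathlib-only imports (pure block algebra in
the style of ★ `K2LiuDoublingUnfoldMainOrbitBlocks` = H4a), lane `--supports stmt-HodgeConjecture-24832 --as helper`.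

SETTING (the TRIANGULAR FRAME of ★ `DoubledUnitarySiegelParabolicAlgebra.conjE_eq`).  For the doubled hermitian space `𝔻 = V ⊕ (−V)` with diagonal
Lagrangian `Δ = {(x, x)}`, conjugating a block matrix `blk h` by `E₁ = (1 0; −1 1)`, `E₂ = E₁⁻¹ = (1 0; 1 1)` puts `Δ` in first position:
`E₁ · blk h · E₂ = (A B; C D)` with `C = (h₂₁ + h₂₂) − (h₁₁ + h₁₂)` the «`Δ → 𝔻/Δ`» block.  In this frame the Siegel parabolic `P_Δ` is `{C = 0}`
(★ `isSiegelDelta_iff_conj`), its unipotent radical `N_Δ` is `{(1 X; 0 1)}` (leaf D9 `mem_unipDelta_iff_conj`), and the Weyl element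
`w_Δ = ι(1, −1)` has frame `W = (1 0; −2 −1)` (D9 `conjE_blk_weylDelta`).  Everything below is stated for FRAME matrices over a commutative
ring `R` (with `2` invertible where the big cell is concerned) and an index type `m`; the one-line transport to `H(𝔸)`, `H(L⁺)` (★ `conjE_eq`,
★ `eq_of_blk_eq`) is left to the consumers (O41.4) once D9 is ★.

* §1 (A1) CELL INVARIANCE `toBlocks₂₁_siegel_mul`, `toBlocks₂₁_mul_siegel`: for a Siegel frame `p = (a b; 0 d)`, the lower-left block of `p·M` is
  `d·C` and of `M·p` is `C·a`; hence over a field `rank C` is a `P_Δ × P_Δ`-invariant (`rank_toBlocks₂₁_siegel_mul`, `rank_toBlocks₂₁_mul_siegel`, for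
  invertible `p`) — the cells `P_Δ \ H / P_Δ ↔ rank C ∈ {0, …, n}` [GPSR87 Part A §1].
* §2 (A2) SMALL CELL `toBlocks₂₁_eq_zero_iff`: `C = 0 ⟺ M = (a b; 0 d)` for some `a b d`.
* §3 (A3) BIG CELL `bigCell_eq`: if `C` is invertible then `(A B; C D) = (a b; 0 d) · W · (1 X; 0 1)` with the EXPLICIT
  `d = −⅟2·C`, `X = C⁻¹D − ⅟2`, `b = A X − B`, `a = A + 2 b`; (A3!) UNIQUENESS `bigCell_unique` — any such factorisation has these `a b d X`
  (the `N_Δ`-component is FREE); `isUnit_det_bigCell_levi` — `a`, `d` are invertible when `M` is; (A4) `isUnit_toBlocks₂₁_of_eq` — conversely every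
  `(a b; 0 d) · W · (1 X; 0 1)` with `d` invertible has invertible lower-left block `−2d`.  So `{C invertible} = P_Δ · w_Δ · N_Δ` with unique
  `N_Δ`-coordinate (`bigCell_existsUnique_unip`, the ∃! form the unfolding consumes): the big Bruhat cell [GPSR87 Part A §1–2; KR94 §1].
PART B (unitarity of the factors, the middle cells) follows the steward's answer on O41.4's needs.

HONEST LABEL.  Count-neutral helper; `HC_CM` is proved only modulo the 7 printed citations (hLiu418 = 24832, h413 = 24833) until rung 0 closes.

## References
* [GelbartPiatetskishapiroRallis1987] S. Gelbart, I. Piatetski-Shapiro, S. Rallis, LNM 1254 (1987), Part A §§1–2 (the doubled group, `P`, `w`, Bruhat cells).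
* [KudlaRallis1994] S. Kudla, S. Rallis, *A regularized Siegel–Weil formula: the first term identity*, Ann. Math. 140 (1994), §1.
-/

namespace Summit.HodgeConjecture.HodgeConjecture.Cruxes.HLiu418.K2LiuSiegelBruhatCells

open Matrix

variable {R : Type*} [CommRing R] {m : Type*} [Fintype m] [DecidableEq m]

/-! ## §1 (A1) Cell invariance of the lower-left block -/

omit [DecidableEq m] in
/-- Left multiplication by a Siegel frame `(a b; 0 d)` multiplies the lower-left block by `d`: `(p·M)₂₁ = d · M₂₁`. [cite: GelbartPiatetskishapiroRallis1987, Part A §1] -/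
theorem toBlocks₂₁_siegel_mul (a b d A B C D : Matrix m m R) :
    (fromBlocks a b 0 d * fromBlocks A B C D).toBlocks₂₁ = d * C := by
  rw [fromBlocks_multiply, toBlocks_fromBlocks₂₁, Matrix.zero_mul, zero_add]

omit [DecidableEq m] in
/-- Right multiplication by a Siegel frame multiplies the lower-left block by `a`: `(M·p)₂₁ = M₂₁ · a`. [cite: GelbartPiatetskishapiroRallis1987, Part A §1] -/
theorem toBlocks₂₁_mul_siegel (a b d A B C D : Matrix m m R) :
    (fromBlocks A B C D * fromBlocks a b 0 d).toBlocks₂₁ = C * a := by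
  rw [fromBlocks_multiply, toBlocks_fromBlocks₂₁, Matrix.mul_zero, add_zero]

/-- A Siegel frame `(a b; 0 d)` is invertible iff `a` and `d` are (`det = det a · det d`). [folklore] -/
theorem isUnit_det_siegel_iff (a b d : Matrix m m R) :
    IsUnit (fromBlocks a b 0 d).det ↔ IsUnit a.det ∧ IsUnit d.det := by
  rw [det_fromBlocks_zero₂₁, IsUnit.mul_iff]

/-- **Cell invariance (left)**: over a field, `rank (p·M)₂₁ = rank M₂₁` for an invertible Siegel frame `p` — the rank of the `Δ → 𝔻/Δ` block is
constant on the double coset `P_Δ M P_Δ`. [cite: GelbartPiatetskishapiroRallis1987, Part A §1] -/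
theorem rank_toBlocks₂₁_siegel_mul {K : Type*} [Field K] (a b d A B C D : Matrix m m K) (hp : IsUnit (fromBlocks a b 0 d).det) :
    ((fromBlocks a b 0 d * fromBlocks A B C D).toBlocks₂₁).rank = C.rank := by
  rw [toBlocks₂₁_siegel_mul]
  exact rank_mul_eq_right_of_isUnit_det d C ((isUnit_det_siegel_iff a b d).1 hp).2

/-- **Cell invariance (right)**: `rank (M·p)₂₁ = rank M₂₁` for an invertible Siegel frame `p`. [cite: GelbartPiatetskishapiroRallis1987, Part A §1] -/
theorem rank_toBlocks₂₁_mul_siegel {K : Type*} [Field K] (a b d A B C D : Matrix m m K) (hp : IsUnit (fromBlocks a b 0 d).det) :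
    ((fromBlocks A B C D * fromBlocks a b 0 d).toBlocks₂₁).rank = C.rank := by
  rw [toBlocks₂₁_mul_siegel]
  exact rank_mul_eq_left_of_isUnit_det a C ((isUnit_det_siegel_iff a b d).1 hp).1

/-! ## §2 (A2) The small cell -/

omit [Fintype m] [DecidableEq m] in
/-- **The small cell**: the lower-left block vanishes iff the frame matrix is a Siegel frame `(a b; 0 d)`.
[cite: GelbartPiatetskishapiroRallis1987, Part A §1] -/
theorem toBlocks₂₁_eq_zero_iff (M : Matrix (m ⊕ m) (m ⊕ m) R) :
    M.toBlocks₂₁ = 0 ↔ ∃ a b d : Matrix m m R, M = fromBlocks a b 0 d := by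
  constructor
  · intro h
    refine ⟨M.toBlocks₁₁, M.toBlocks₁₂, M.toBlocks₂₂, ?_⟩
    conv_lhs => rw [← fromBlocks_toBlocks M]
    rw [h]
  · rintro ⟨a, b, d, rfl⟩
    exact toBlocks_fromBlocks₂₁ a b 0 d

/-! ## §3 (A3)–(A4) The big cell `P_Δ · w_Δ · N_Δ` with free `N_Δ`-component -/

omit [Fintype m] in
/-- The numeral `2` of `Matrix m m R` is the scalar `2 • 1` (bookkeeping for the frame `W = (1 0; −2 −1)` of `w_Δ`). [folklore] -/
theorem two_eq_smul_one : (2 : Matrix m m R) = (2 : R) • (1 : Matrix m m R) := by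
  rw [← one_add_one_eq_two, ← one_add_one_eq_two, add_smul, one_smul]

/-- The product `(a b; 0 d) · W · (1 X; 0 1)`, `W = (1 0; −2 −1)` the frame of `w_Δ`, blockwise:
`= (a − 2b, (a − 2b) X − b; −2d, −2 d X − d)`. [cite: GelbartPiatetskishapiroRallis1987, Part A §1] -/
theorem siegel_mul_weyl_mul_unip (a b d X : Matrix m m R) :
    fromBlocks a b 0 d * fromBlocks 1 0 (-2) (-1) * fromBlocks 1 X 0 1 =
      fromBlocks (a - (2 : R) • b) ((a - (2 : R) • b) * X - b) (-((2 : R) • d)) (-((2 : R) • d) * X - d) := by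
  rw [two_eq_smul_one, fromBlocks_multiply, fromBlocks_multiply]
  simp only [Matrix.mul_one, Matrix.mul_zero, add_zero, zero_add, Matrix.mul_neg, Matrix.mul_smul]
  rw [fromBlocks_inj]
  exact ⟨by rw [sub_eq_add_neg], by rw [sub_eq_add_neg, sub_eq_add_neg], rfl, by rw [sub_eq_add_neg]⟩

/-- **(A4) Elements of `P_Δ · w_Δ · N_Δ` have lower-left block `−2d`**, invertible as soon as `d` and `2` are.
[cite: GelbartPiatetskishapiroRallis1987, Part A §1] -/
theorem toBlocks₂₁_siegel_mul_weyl_mul_unip (a b d X : Matrix m m R) :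
    (fromBlocks a b 0 d * fromBlocks 1 0 (-2) (-1) * fromBlocks 1 X 0 1).toBlocks₂₁ = -((2 : R) • d) := by
  rw [siegel_mul_weyl_mul_unip, toBlocks_fromBlocks₂₁]

/-- (A4, units) `−2d` is invertible when `d` is and `2 ∈ Rˣ`. [folklore] -/
theorem isUnit_det_neg_two_smul [Invertible (2 : R)] {d : Matrix m m R} (hd : IsUnit d.det) : IsUnit (-((2 : R) • d)).det := by
  rw [det_neg, det_smul]
  exact (isUnit_neg_one.pow _).mul (((isUnit_of_invertible (2 : R)).pow _).mul hd)

/-- **(A3) THE BIG CELL — existence with explicit factors.**  If the lower-left block `C` of a frame matrix `(A B; C D)` is invertible (and `2 ∈ Rˣ`),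
then `(A B; C D) = (a b; 0 d) · W · (1 X; 0 1)` with `d = −⅟2 C`, `X = C⁻¹ D − ⅟2`, `b = A X − B`, `a = A + 2 b`: the matrix lies in
`P_Δ · w_Δ · N_Δ`. [cite: GelbartPiatetskishapiroRallis1987, Part A §§1–2] [cite: KudlaRallis1994, §1] -/
theorem bigCell_eq [Invertible (2 : R)] (A B C D : Matrix m m R) (hC : IsUnit C.det) :
    fromBlocks A B C D =
      fromBlocks (A + (2 : R) • (A * (C⁻¹ * D - (⅟ (2 : R)) • 1) - B)) (A * (C⁻¹ * D - (⅟ (2 : R)) • 1) - B) 0 (-((⅟ (2 : R)) • C)) *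
        fromBlocks 1 0 (-2) (-1) * fromBlocks 1 (C⁻¹ * D - (⅟ (2 : R)) • 1) 0 1 := by
  rw [siegel_mul_weyl_mul_unip, fromBlocks_inj]
  have h2 : (2 : R) * ⅟ (2 : R) = 1 := mul_invOf_self (2 : R)
  have hCC : C * C⁻¹ = 1 := Matrix.mul_nonsing_inv C hC
  refine ⟨?_, ?_, ?_, ?_⟩
  · rw [add_sub_cancel_right]
  · rw [add_sub_cancel_right, sub_sub_cancel]
  · rw [smul_neg, neg_neg, smul_smul, h2, one_smul]
  · rw [smul_neg, neg_neg, smul_smul, h2, one_smul, sub_neg_eq_add, Matrix.mul_sub, ← Matrix.mul_assoc, hCC, Matrix.one_mul,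
      Matrix.mul_smul, Matrix.mul_one, sub_add_cancel]

/-- **(A3!) THE BIG CELL — uniqueness (the `N_Δ`-component is FREE).**  If `(A B; C D) = (a b; 0 d) · W · (1 X; 0 1)` with `C` invertible
(and `2 ∈ Rˣ`), then necessarily `d = −⅟2 C`, `X = C⁻¹ D − ⅟2`, `b = A X − B` and `a = A + 2 b`.  In particular the `N_Δ(F)`-coordinate `X`
of a big-cell element is unique: `P_Δ w_Δ n = P_Δ w_Δ n′ ⟹ n = n′`. [cite: GelbartPiatetskishapiroRallis1987, Part A §§1–2] -/
theorem bigCell_unique [Invertible (2 : R)] {A B C D a b d X : Matrix m m R} (hC : IsUnit C.det)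
    (h : fromBlocks A B C D = fromBlocks a b 0 d * fromBlocks 1 0 (-2) (-1) * fromBlocks 1 X 0 1) :
    d = -((⅟ (2 : R)) • C) ∧ X = C⁻¹ * D - (⅟ (2 : R)) • 1 ∧ b = A * X - B ∧ a = A + (2 : R) • b := by
  rw [siegel_mul_weyl_mul_unip, fromBlocks_inj] at h
  obtain ⟨hA, hB, hC', hD⟩ := h
  -- `d = −⅟2 C`
  have hd : d = -((⅟ (2 : R)) • C) := by
    rw [hC', smul_neg, smul_smul, invOf_mul_self, one_smul, neg_neg]
  -- `C X = D − ⅟2 C`, i.e. `X = C⁻¹ D − ⅟2`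
  have hCX : C * X = D - (⅟ (2 : R)) • C := by
    have h1 : -((2 : R) • d) = C := hC'.symm
    rw [hD, h1, hd, sub_neg_eq_add, add_sub_cancel_right]
  have hX : X = C⁻¹ * D - (⅟ (2 : R)) • 1 := by
    have hinv : C⁻¹ * C = 1 := Matrix.nonsing_inv_mul C hC
    calc X = C⁻¹ * (C * X) := by rw [← Matrix.mul_assoc, hinv, Matrix.one_mul]
      _ = C⁻¹ * D - (⅟ (2 : R)) • 1 := by rw [hCX, Matrix.mul_sub, Matrix.mul_smul, hinv]
  -- `b = A X − B`, `a = A + 2 b`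
  have hb : b = A * X - B := by
    rw [hB, ← hA, sub_sub_cancel]
  have ha : a = A + (2 : R) • b := by
    rw [hA, sub_add_cancel]
  exact ⟨hd, hX, hb, ha⟩

/-- **(A3, ∃! form) `N_Δ(F)` acts FREELY on the big cell**: a frame matrix with invertible lower-left block has EXACTLY ONE `N_Δ`-coordinate `X` with
`(A B; C D) ∈ P_Δ · W · (1 X; 0 1)` — the form the unfolding of the constant term along `P_Δ` consumes («`P w_Δ P = ⊔_{n ∈ N_Δ(F)} P w_Δ n`»).
[cite: GelbartPiatetskishapiroRallis1987, Part A §§1–2] [cite: KudlaRallis1994, §1] -/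
theorem bigCell_existsUnique_unip [Invertible (2 : R)] (A B C D : Matrix m m R) (hC : IsUnit C.det) :
    ∃! X : Matrix m m R, ∃ a b d : Matrix m m R,
      fromBlocks A B C D = fromBlocks a b 0 d * fromBlocks 1 0 (-2) (-1) * fromBlocks 1 X 0 1 :=
  ⟨C⁻¹ * D - (⅟ (2 : R)) • 1, ⟨_, _, _, bigCell_eq A B C D hC⟩, fun _ ⟨_, _, _, h⟩ => (bigCell_unique hC h).2.1⟩

/-- **Invertibility of the Levi factors**: in the big-cell factorisation `M = (a b; 0 d) · W · (1 X; 0 1)`, `det M = det a · det d · (−1)^m`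
(up to the sign `det W`), so `a` and `d` are invertible whenever `M` is. [folklore] -/
theorem isUnit_det_bigCell_levi {A B C D a b d X : Matrix m m R}
    (h : fromBlocks A B C D = fromBlocks a b 0 d * fromBlocks 1 0 (-2) (-1) * fromBlocks 1 X 0 1) (hM : IsUnit (fromBlocks A B C D).det) :
    IsUnit a.det ∧ IsUnit d.det := by
  rw [h, det_mul, det_mul, IsUnit.mul_iff, IsUnit.mul_iff] at hM
  exact (isUnit_det_siegel_iff a b d).1 hM.1.1

end Summit.HodgeConjecture.HodgeConjecture.Cruxes.HLiu418.K2LiuSiegelBruhatCells
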